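import Literature.Barriers.CriticalPhenomena.PlaquetteWalkHoleRootLateralCellLaw
import Literature.Barriers.CriticalPhenomena.PlaquetteWalkHoleRootMirrorZeros
import Literature.Barriers.CriticalPhenomena.PlaquetteWalkAngleAnalyticity
import Literature.Barriers.CriticalPhenomena.PlaquetteWalkHoleRootRingLaws
import HarnessLib

/-!
# Barrier catalogue (SAWScalingLimit): CONTINUITY ZEROS of the Yang–Baxter vertex functional at the far cell of a
hole root — a sign change of the route-mass difference forces an EXACT zero of the defect at an intermediate angle

Composition of three catalogue entries: the FAR-CELL LAW (`PlaquetteWalkHoleRootFarCellLaw`: for a hole root in the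
`W`-normalisation — root on the `W` side of the root plaquette `w`, hole `holeFaceW w = (w.1 − 1, w.2) ∉ D`, far cell
`farW w = (w.1 − 2, w.2) ∈ D` — the printed vertex functional at the far cell is `i·v(θ)·(M_N(θ) − M_S(θ))` for every
`θ ∈ [π/3, 2π/3]`, in particular purely imaginary), the LATERAL-CELL LAW (`PlaquetteWalkHoleRootLateralCellLaw`: at the
lateral cell `latN w = (w.1 − 1, w.2 + 1)` above the hole the functional is `i·v(θ)·e^{i(3θ/8 + 5π/8)}·(M_W(θ) − M_E(θ))`, a
real multiple of a θ-dependent unit) and the ANGLE ANALYTICITY of the printed vertex functional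
(`PlaquetteWalkAngleAnalyticity`: `θ ↦ VF_{Dl}(a, f₀; θ)` is real-analytic, hence continuous, on `(0, π)`).
Bolzano's intermediate value theorem then gives:

* §A (general plaquette) `vertexFunctional_printed_exists_eq_zero_of_re_eq_zero` — if on an angle interval
  `[θ₁, θ₂] ⊆ (0, π)` the vertex functional of `(Dl, a, f₀)` has vanishing real part and its imaginary parts at the two
  ends have opposite (weak) signs, it vanishes EXACTLY at some angle of `[θ₁, θ₂]`;
* §B (far cell of a hole root) ★★ `vertexFunctional_printed_farCellW_exists_eq_zero_of_im_mul_im_nonpos` /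
  `…_of_routeMass_sign_change` — a (weak) sign change of `Im VF`, equivalently of the route-mass difference
  `M_N − M_S`, between two printed angles forces a zero of the far-cell defect in between; ★★ the STRICT form
  `vertexFunctional_printed_farCellW_exists_eq_zero_Ioo` puts the zero in the OPEN interval when the end values are
  non-zero, and `…_exists_eq_zero_ne_pi_div_two` records that such a zero is OFF the mirror point `π/2` as soon as
  `VF(π/2) ≠ 0`;
* §C (lateral cell above the hole) ★★ `vertexFunctional_printed_latN_exists_eq_zero_of_routeMass_sign_change` and its
  strict form `…latN_exists_eq_zero_Ioo` — the same mechanism along the rotating line `e^{i(3θ/8 + 5π/8)}·iℝ`: the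
  rotated functional `conj(e^{i(3θ/8+5π/8)})·VF` is purely imaginary with imaginary part `v(θ)·(M_W − M_E)`;
* §D (edition 3: the far cell in the three other orientations, by the catalogue's mirror transport
  `PlaquetteWalkHoleRootMirrorZeros` §A) `vertexFunctional_printed_exists_eq_zero_of_rotated` — the ROTATED LINE LEMMA
  (a continuous non-vanishing rotation `c(θ)` with `Re(c·VF) ≡ 0` and a weak sign change of `Im(c·VF)` ⇒ an exact
  zero), ★★ `vertexFunctional_printed_farCellE_exists_eq_zero_of_im_mul_im_nonpos` (hole EAST of the root plaquette),
  ★★ `…farCellS…` / `…farCellN…_of_rotated_im_mul_nonpos` (hole BELOW / ABOVE: rotation by `conj r(θ)`, `r` the contour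
  coefficient `ybRatio`) — continuity zeros of the far-cell defect exist in every orientation of the hole root.
* §E (edition 4: the lateral cell BELOW the hole, by the ring's cell law at `LS`,
  `PlaquetteWalkHoleRootRingLaws`) `im_conj_lsRot_mul_classTermLS_eq_zero` / `re_conj_lsRot_mul_classTermLS_of_W/_of_E` —
  after rotation by `conj(e^{i·3θ/8})` every class term at `latS w = (w.1 − 1, w.2 − 1)` is REAL: `+ext` for a wound walk
  entering from `W`, `−ext` for one entering from `E`, `0` for an unwound walk; hence ★★
  `conj_lsRot_mul_vertexFunctional_printed_latS_re_im` (the rotated defect is purely imaginary with imaginary part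
  `v(θ)·(M_W − M_E)`, the signed wound mass written as `Σ Re(conj(e^{i·3θ/8})·classTermLS)`), ★★
  `vertexFunctional_printed_latS_exists_eq_zero_of_signedMass_sign_change` and its strict form `…latS_exists_eq_zero_Ioo`
  — the row-mirror twin of §C: a weak sign change of `M_W − M_E` between two printed angles forces an exact zero of the
  defect below the hole.

Why it is recorded (venture lane «pcv-sawmu», HOME `FINDING-YB-OFF-MIRROR-ZEROS.md`, b-step0 gen 20): the lane's
conjectured encircling criterion «a wound class-B2a walk at f₀ ⇒ VF(a, f₀) ≠ 0» was refuted at `θ = π/2` by the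
mirror zeros of row-symmetric domains (`PlaquetteWalkHoleRootMirrorZeros`) and left open at every other angle. These
lemmas are the mechanism of a FOURTH species of exact zeros — at the two-direction cells of the ring the condition
`VF = 0` is ONE real equation in the one real parameter `θ`, so zeros occur at isolated, non-special angles whenever the
route-mass difference changes sign — and reduce any such instance to two sign facts and one non-vanishing fact at
chosen angles. Instances (exact arithmetic in `ℚ(ζ₃₂)`, HOME, not theorems of this file): far cell of `5×5 ∖ {(2,2),(0,4)}`
with the `W`-root of `w = (3,2)`: `Im VF(π/3) > 0`, `Im VF(2π/3) < 0`, `VF(π/2) ≠ 0`, whence a zero at `θ* ≈ 0.4401·π`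
with both routes wound; lateral cell `latN` of `5×5 ∖ {(2,2),(4,4)}`, same root: `M_W − M_E` changes sign between `π/3`
and `π/2`, whence a zero at `θ ≈ 0.3333·π + 1.4·10⁻⁵·π`, next to but not at the honeycomb angle. Not in print in this form (the printed sources treat simply connected domains, where the vertex
relation holds identically); elementary given the two parents.

References: A. Glazman, I. Manolescu, arXiv:1708.00395v3, Lemma 2.1 and eq. (1) [GlazmanManolescu2019]; A. Glazman,
Electron. Commun. Probab. 20 (2015) no. 86, Lemma 3.1 [Glazman2015WeightedSAW]; H. Duminil-Copin, S. Smirnov, Ann. of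
Math. 175 (2012), Lemma 1 [DuminilCopinSmirnov2012].
-/

noncomputable section

namespace Literature.Barriers.CriticalPhenomena.PlaquetteWalk

open Literature.Probability.RandomPlanarGeometry.SAW.YangBaxter
open Real Complex

/-! ## §A Continuity in the angle and the general line lemma -/

section General

/-- **The printed vertex functional is continuous in the angle** on `(0, π)` (it is real-analytic there).
[cite: GlazmanManolescu2019, Lemma 2.1 and eq. (1)] -/
theorem continuousOn_vertexFunctional_printed (Dl : List Face) (a : MidEdge) (f₀ : Face) :
    ContinuousOn (fun θ => vertexFunctional (printedWeights θ) tFiveEighths (ybCoeff θ) Dl a f₀) (Set.Ioo 0 π) :=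
  (analyticOnNhd_vertexFunctional_printed Dl a f₀).continuousOn

/-- The imaginary part of the printed vertex functional is continuous on every angle interval `[θ₁, θ₂] ⊆ (0, π)`.
[cite: GlazmanManolescu2019, Lemma 2.1 and eq. (1)] -/
theorem continuousOn_im_vertexFunctional_printed (Dl : List Face) (a : MidEdge) (f₀ : Face) {θ₁ θ₂ : ℝ}
    (h₁ : 0 < θ₁) (h₂ : θ₂ < π) :
    ContinuousOn (fun θ => (vertexFunctional (printedWeights θ) tFiveEighths (ybCoeff θ) Dl a f₀).im)
      (Set.Icc θ₁ θ₂) :=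
  Complex.continuous_im.comp_continuousOn
    ((continuousOn_vertexFunctional_printed Dl a f₀).mono fun _ hθ => ⟨lt_of_lt_of_le h₁ hθ.1, lt_of_le_of_lt hθ.2 h₂⟩)

/-- ★ **LINE LEMMA (Bolzano for the defect).** If on `[θ₁, θ₂] ⊆ (0, π)` the printed vertex functional of
`(Dl, a, f₀)` has vanishing real part, and its imaginary part is `≥ 0` at one end and `≤ 0` at the other, then it
vanishes EXACTLY at some angle of `[θ₁, θ₂]`. [cite: GlazmanManolescu2019, Lemma 2.1 and eq. (1)] -/
theorem vertexFunctional_printed_exists_eq_zero_of_re_eq_zero (Dl : List Face) (a : MidEdge) (f₀ : Face)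
    {θ₁ θ₂ : ℝ} (h12 : θ₁ ≤ θ₂) (h₁ : 0 < θ₁) (h₂ : θ₂ < π)
    (hre : ∀ θ ∈ Set.Icc θ₁ θ₂, (vertexFunctional (printedWeights θ) tFiveEighths (ybCoeff θ) Dl a f₀).re = 0)
    (hsign : (vertexFunctional (printedWeights θ₁) tFiveEighths (ybCoeff θ₁) Dl a f₀).im *
        (vertexFunctional (printedWeights θ₂) tFiveEighths (ybCoeff θ₂) Dl a f₀).im ≤ 0) :
    ∃ θ ∈ Set.Icc θ₁ θ₂, vertexFunctional (printedWeights θ) tFiveEighths (ybCoeff θ) Dl a f₀ = 0 := by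
  set g : ℝ → ℝ := fun θ => (vertexFunctional (printedWeights θ) tFiveEighths (ybCoeff θ) Dl a f₀).im with hg
  have hcont : ContinuousOn g (Set.Icc θ₁ θ₂) := continuousOn_im_vertexFunctional_printed Dl a f₀ h₁ h₂
  have hzero : ∃ θ ∈ Set.Icc θ₁ θ₂, g θ = 0 := by
    rcases mul_nonpos_iff.1 hsign with ⟨ha, hb⟩ | ⟨ha, hb⟩
    · -- g θ₁ ≥ 0 ≥ g θ₂ : decreasing crossing
      obtain ⟨θ, hθ, hθ0⟩ := intermediate_value_Icc' h12 hcont ⟨hb, ha⟩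
      exact ⟨θ, hθ, hθ0⟩
    · obtain ⟨θ, hθ, hθ0⟩ := intermediate_value_Icc h12 hcont ⟨ha, hb⟩
      exact ⟨θ, hθ, hθ0⟩
  obtain ⟨θ, hθ, hθ0⟩ := hzero
  refine ⟨θ, hθ, ?_⟩
  apply Complex.ext
  · simpa using hre θ hθ
  · simpa [hg] using hθ0

end General

/-! ## §B The far cell of a hole root: sign changes of the route-mass difference force exact zeros -/

section FarCell

/-- The angle interval of two printed angles lies inside `(0, π)`: lower end. [folklore] -/
private theorem pos_of_mem_printed {θ : ℝ} (hθ : θ ∈ Set.Icc (π / 3) (2 * π / 3)) : 0 < θ := by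
  linarith [hθ.1, Real.pi_pos]

/-- The angle interval of two printed angles lies inside `(0, π)`: upper end. [folklore] -/
private theorem lt_pi_of_mem_printed {θ : ℝ} (hθ : θ ∈ Set.Icc (π / 3) (2 * π / 3)) : θ < π := by
  linarith [hθ.2, Real.pi_pos]

/-- **The imaginary part of the far-cell defect is `v(θ)·(M_N − M_S)`** (the far-cell law, coordinate form).
[cite: GlazmanManolescu2019, Lemma 2.1 (statement, "in the form given in [Gl]")] [cite: Glazman2015WeightedSAW, Lemma 3.1 (proof, pp. 6–7)] -/
theorem vertexFunctional_printed_farCellW_im_eq {θ : ℝ} (hθ : θ ∈ Set.Icc (π / 3) (2 * π / 3))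
    (Dl : List Face) (w : Face) (hf : farW w ∈ Dl) (hh : holeFaceW w ∉ dom Dl)
    (hr : RootedFace (dom Dl) (w.side .W) (farW w)) :
    (vertexFunctional (printedWeights θ) tFiveEighths (ybCoeff θ) Dl (w.side .W) (farW w)).im =
      weightV θ *
        ((∑ ω ∈ ΩG.setB2a (dom Dl) (w.side .W) (farW w), ΩG.routeMassW θ hr .N ω) -
          ∑ ω ∈ ΩG.setB2a (dom Dl) (w.side .W) (farW w), ΩG.routeMassW θ hr .S ω) := by
  rw [vertexFunctional_printed_farCellW_eq hθ Dl w hf hh hr]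
  simp [Complex.mul_im, Complex.mul_re]

/-- ★★ **CONTINUITY ZEROS AT THE FAR CELL (imaginary-part form).** For two printed angles `θ₁ ≤ θ₂` at which the
imaginary parts of the far-cell defect have opposite weak signs (`Im VF(θ₁) · Im VF(θ₂) ≤ 0`), the defect vanishes
EXACTLY at some `θ ∈ [θ₁, θ₂]`. [cite: GlazmanManolescu2019, Lemma 2.1 (statement, "in the form given in [Gl]")]
[cite: Glazman2015WeightedSAW, Lemma 3.1 (proof, pp. 6–7)] [cite: DuminilCopinSmirnov2012, proof of Lemma 1] -/
theorem vertexFunctional_printed_farCellW_exists_eq_zero_of_im_mul_im_nonpos {θ₁ θ₂ : ℝ} (h12 : θ₁ ≤ θ₂)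
    (hθ₁ : θ₁ ∈ Set.Icc (π / 3) (2 * π / 3)) (hθ₂ : θ₂ ∈ Set.Icc (π / 3) (2 * π / 3))
    (Dl : List Face) (w : Face) (hf : farW w ∈ Dl) (hh : holeFaceW w ∉ dom Dl)
    (hsign : (vertexFunctional (printedWeights θ₁) tFiveEighths (ybCoeff θ₁) Dl (w.side .W) (farW w)).im *
        (vertexFunctional (printedWeights θ₂) tFiveEighths (ybCoeff θ₂) Dl (w.side .W) (farW w)).im ≤ 0) :
    ∃ θ ∈ Set.Icc θ₁ θ₂,
      vertexFunctional (printedWeights θ) tFiveEighths (ybCoeff θ) Dl (w.side .W) (farW w) = 0 :=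
  vertexFunctional_printed_exists_eq_zero_of_re_eq_zero Dl (w.side .W) (farW w) h12 (pos_of_mem_printed hθ₁)
    (lt_pi_of_mem_printed hθ₂)
    (fun _ hθ => vertexFunctional_printed_farCellW_re_eq_zero
      ⟨le_trans hθ₁.1 hθ.1, le_trans hθ.2 hθ₂.2⟩ Dl w hf hh)
    hsign

/-- ★★ **CONTINUITY ZEROS AT THE FAR CELL (route-mass form).** If the route-mass difference `M_N − M_S` of the wound
class-`B2a` walks at the far cell is `≥ 0` at one printed angle and `≤ 0` at another (in either order), the far-cell
defect vanishes EXACTLY at some angle between them. [cite: GlazmanManolescu2019, Lemma 2.1 (statement, "in the form given in [Gl]")]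
[cite: Glazman2015WeightedSAW, Lemma 3.1, eq. (1) (the weight v(θ) ≥ 0)] [cite: DuminilCopinSmirnov2012, proof of Lemma 1] -/
theorem vertexFunctional_printed_farCellW_exists_eq_zero_of_routeMass_sign_change {θ₁ θ₂ : ℝ} (h12 : θ₁ ≤ θ₂)
    (hθ₁ : θ₁ ∈ Set.Icc (π / 3) (2 * π / 3)) (hθ₂ : θ₂ ∈ Set.Icc (π / 3) (2 * π / 3))
    (Dl : List Face) (w : Face) (hf : farW w ∈ Dl) (hh : holeFaceW w ∉ dom Dl)
    (hr : RootedFace (dom Dl) (w.side .W) (farW w))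
    (hsign : ((∑ ω ∈ ΩG.setB2a (dom Dl) (w.side .W) (farW w), ΩG.routeMassW θ₁ hr .N ω) -
          ∑ ω ∈ ΩG.setB2a (dom Dl) (w.side .W) (farW w), ΩG.routeMassW θ₁ hr .S ω) *
        ((∑ ω ∈ ΩG.setB2a (dom Dl) (w.side .W) (farW w), ΩG.routeMassW θ₂ hr .N ω) -
          ∑ ω ∈ ΩG.setB2a (dom Dl) (w.side .W) (farW w), ΩG.routeMassW θ₂ hr .S ω) ≤ 0) :
    ∃ θ ∈ Set.Icc θ₁ θ₂,
      vertexFunctional (printedWeights θ) tFiveEighths (ybCoeff θ) Dl (w.side .W) (farW w) = 0 := by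
  apply vertexFunctional_printed_farCellW_exists_eq_zero_of_im_mul_im_nonpos h12 hθ₁ hθ₂ Dl w hf hh
  rw [vertexFunctional_printed_farCellW_im_eq hθ₁ Dl w hf hh hr,
    vertexFunctional_printed_farCellW_im_eq hθ₂ Dl w hf hh hr]
  have hv₁ := weightV_nonneg hθ₁
  have hv₂ := weightV_nonneg hθ₂
  -- (v₁ Δ₁)(v₂ Δ₂) = (v₁ v₂)(Δ₁ Δ₂) with v₁ v₂ ≥ 0 and Δ₁ Δ₂ ≤ 0
  have key : weightV θ₁ * weightV θ₂ *
      (((∑ ω ∈ ΩG.setB2a (dom Dl) (w.side .W) (farW w), ΩG.routeMassW θ₁ hr .N ω) -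
          ∑ ω ∈ ΩG.setB2a (dom Dl) (w.side .W) (farW w), ΩG.routeMassW θ₁ hr .S ω) *
        ((∑ ω ∈ ΩG.setB2a (dom Dl) (w.side .W) (farW w), ΩG.routeMassW θ₂ hr .N ω) -
          ∑ ω ∈ ΩG.setB2a (dom Dl) (w.side .W) (farW w), ΩG.routeMassW θ₂ hr .S ω)) ≤ 0 :=
    mul_nonpos_of_nonneg_of_nonpos (mul_nonneg hv₁ hv₂) hsign
  nlinarith [key]

/-- ★★ **STRICT FORM: a zero in the OPEN interval.** If, moreover, the far-cell defect does not vanish at the two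
end angles, the zero lies strictly between them. [cite: GlazmanManolescu2019, Lemma 2.1 (statement, "in the form given in [Gl]")]
[cite: Glazman2015WeightedSAW, Lemma 3.1 (proof, pp. 6–7)] [cite: DuminilCopinSmirnov2012, proof of Lemma 1] -/
theorem vertexFunctional_printed_farCellW_exists_eq_zero_Ioo {θ₁ θ₂ : ℝ} (h12 : θ₁ ≤ θ₂)
    (hθ₁ : θ₁ ∈ Set.Icc (π / 3) (2 * π / 3)) (hθ₂ : θ₂ ∈ Set.Icc (π / 3) (2 * π / 3))
    (Dl : List Face) (w : Face) (hf : farW w ∈ Dl) (hh : holeFaceW w ∉ dom Dl)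
    (hsign : (vertexFunctional (printedWeights θ₁) tFiveEighths (ybCoeff θ₁) Dl (w.side .W) (farW w)).im *
        (vertexFunctional (printedWeights θ₂) tFiveEighths (ybCoeff θ₂) Dl (w.side .W) (farW w)).im ≤ 0)
    (hne₁ : vertexFunctional (printedWeights θ₁) tFiveEighths (ybCoeff θ₁) Dl (w.side .W) (farW w) ≠ 0)
    (hne₂ : vertexFunctional (printedWeights θ₂) tFiveEighths (ybCoeff θ₂) Dl (w.side .W) (farW w) ≠ 0) :
    ∃ θ ∈ Set.Ioo θ₁ θ₂,
      vertexFunctional (printedWeights θ) tFiveEighths (ybCoeff θ) Dl (w.side .W) (farW w) = 0 := by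
  obtain ⟨θ, hθ, hz⟩ :=
    vertexFunctional_printed_farCellW_exists_eq_zero_of_im_mul_im_nonpos h12 hθ₁ hθ₂ Dl w hf hh hsign
  have h1 : θ ≠ θ₁ := fun e => hne₁ (e ▸ hz)
  have h2 : θ ≠ θ₂ := fun e => hne₂ (e ▸ hz)
  exact ⟨θ, ⟨lt_of_le_of_ne hθ.1 (Ne.symm h1), lt_of_le_of_ne hθ.2 h2⟩, hz⟩

/-- ★★ **OFF-MIRROR ZEROS.** Under the hypotheses of the strict form and `VF(π/2) ≠ 0` at the far cell, the defect
has an exact zero at an angle of `(θ₁, θ₂)` DIFFERENT from the mirror point `π/2` — zeros of the far-cell defect are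
not confined to the symmetry angle. [cite: GlazmanManolescu2019, Lemma 2.1 and §1 (the remark on θ ↔ π − θ)]
[cite: Glazman2015WeightedSAW, Lemma 3.1 (proof, pp. 6–7)] [cite: DuminilCopinSmirnov2012, proof of Lemma 1] -/
theorem vertexFunctional_printed_farCellW_exists_eq_zero_ne_pi_div_two {θ₁ θ₂ : ℝ} (h12 : θ₁ ≤ θ₂)
    (hθ₁ : θ₁ ∈ Set.Icc (π / 3) (2 * π / 3)) (hθ₂ : θ₂ ∈ Set.Icc (π / 3) (2 * π / 3))
    (Dl : List Face) (w : Face) (hf : farW w ∈ Dl) (hh : holeFaceW w ∉ dom Dl)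
    (hsign : (vertexFunctional (printedWeights θ₁) tFiveEighths (ybCoeff θ₁) Dl (w.side .W) (farW w)).im *
        (vertexFunctional (printedWeights θ₂) tFiveEighths (ybCoeff θ₂) Dl (w.side .W) (farW w)).im ≤ 0)
    (hne₁ : vertexFunctional (printedWeights θ₁) tFiveEighths (ybCoeff θ₁) Dl (w.side .W) (farW w) ≠ 0)
    (hne₂ : vertexFunctional (printedWeights θ₂) tFiveEighths (ybCoeff θ₂) Dl (w.side .W) (farW w) ≠ 0)
    (hmid : vertexFunctional (printedWeights (π / 2)) tFiveEighths (ybCoeff (π / 2)) Dl (w.side .W) (farW w) ≠ 0) :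
    ∃ θ ∈ Set.Ioo θ₁ θ₂, θ ≠ π / 2 ∧
      vertexFunctional (printedWeights θ) tFiveEighths (ybCoeff θ) Dl (w.side .W) (farW w) = 0 := by
  obtain ⟨θ, hθ, hz⟩ := vertexFunctional_printed_farCellW_exists_eq_zero_Ioo h12 hθ₁ hθ₂ Dl w hf hh hsign hne₁ hne₂
  exact ⟨θ, hθ, fun e => hmid (e ▸ hz), hz⟩

end FarCell

/-! ## §C The lateral cell above the hole: the same mechanism along a rotating line -/

section LateralCell

/-- `latDir` is continuous in the angle. [cite: Glazman2015WeightedSAW, Lemma 3.1, eq. (1) (the weights)] -/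
theorem continuous_latDir : Continuous latDir := by
  unfold latDir
  exact Complex.continuous_exp.comp
    ((Complex.continuous_ofReal.comp (by fun_prop)).mul continuous_const)

/-- `conj(latDir θ)·latDir θ = 1` (a unit). [cite: Glazman2015WeightedSAW, Lemma 3.1, eq. (1) (the weights)] -/
theorem conj_latDir_mul_latDir (θ : ℝ) : (starRingEnd ℂ) (latDir θ) * latDir θ = 1 := by
  rw [← Complex.normSq_eq_conj_mul_self, Complex.normSq_eq_norm_sq, norm_latDir]
  simp

/-- **The rotated lateral defect** `conj(latDir θ)·VF_D(w.side W, latN w)` equals `i·v(θ)·(M_W − M_E)` (the lateral-cell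
law, rotated onto the imaginary axis). [cite: GlazmanManolescu2019, Lemma 2.1 (statement, "in the form given in [Gl]")]
[cite: Glazman2015WeightedSAW, Lemma 3.1 (proof, pp. 6–7)] -/
theorem conj_latDir_mul_vertexFunctional_printed_latN_eq {θ : ℝ} (hθ : θ ∈ Set.Icc (π / 3) (2 * π / 3))
    (Dl : List Face) (w : Face) (hf : latN w ∈ Dl) (hh : holeFaceW w ∉ dom Dl)
    (hr : RootedFace (dom Dl) (w.side .W) (latN w)) :
    (starRingEnd ℂ) (latDir θ) * vertexFunctional (printedWeights θ) tFiveEighths (ybCoeff θ) Dl (w.side .W) (latN w) =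
      Complex.I * (weightV θ : ℂ) *
        (((∑ ω ∈ ΩG.setB2a (dom Dl) (w.side .W) (latN w), ΩG.routeMassL θ hr .W ω) -
          ∑ ω ∈ ΩG.setB2a (dom Dl) (w.side .W) (latN w), ΩG.routeMassL θ hr .E ω : ℝ) : ℂ) := by
  rw [vertexFunctional_printed_latN_eq hθ Dl w hf hh hr]
  have h1 := conj_latDir_mul_latDir θ
  calc (starRingEnd ℂ) (latDir θ) * (Complex.I * (weightV θ : ℂ) * latDir θ *
        (((∑ ω ∈ ΩG.setB2a (dom Dl) (w.side .W) (latN w), ΩG.routeMassL θ hr .W ω) -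
          ∑ ω ∈ ΩG.setB2a (dom Dl) (w.side .W) (latN w), ΩG.routeMassL θ hr .E ω : ℝ) : ℂ))
      = ((starRingEnd ℂ) (latDir θ) * latDir θ) * (Complex.I * (weightV θ : ℂ) *
        (((∑ ω ∈ ΩG.setB2a (dom Dl) (w.side .W) (latN w), ΩG.routeMassL θ hr .W ω) -
          ∑ ω ∈ ΩG.setB2a (dom Dl) (w.side .W) (latN w), ΩG.routeMassL θ hr .E ω : ℝ) : ℂ)) := by ring
    _ = _ := by rw [h1, one_mul]

/-- The rotated lateral defect has vanishing real part and imaginary part `v(θ)·(M_W − M_E)` on the printed range.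
[cite: GlazmanManolescu2019, Lemma 2.1 (statement, "in the form given in [Gl]")] [cite: Glazman2015WeightedSAW, Lemma 3.1 (proof, pp. 6–7)] -/
theorem conj_latDir_mul_vertexFunctional_printed_latN_re_im {θ : ℝ} (hθ : θ ∈ Set.Icc (π / 3) (2 * π / 3))
    (Dl : List Face) (w : Face) (hf : latN w ∈ Dl) (hh : holeFaceW w ∉ dom Dl)
    (hr : RootedFace (dom Dl) (w.side .W) (latN w)) :
    ((starRingEnd ℂ) (latDir θ) *
        vertexFunctional (printedWeights θ) tFiveEighths (ybCoeff θ) Dl (w.side .W) (latN w)).re = 0 ∧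
      ((starRingEnd ℂ) (latDir θ) *
          vertexFunctional (printedWeights θ) tFiveEighths (ybCoeff θ) Dl (w.side .W) (latN w)).im =
        weightV θ *
          ((∑ ω ∈ ΩG.setB2a (dom Dl) (w.side .W) (latN w), ΩG.routeMassL θ hr .W ω) -
            ∑ ω ∈ ΩG.setB2a (dom Dl) (w.side .W) (latN w), ΩG.routeMassL θ hr .E ω) := by
  rw [conj_latDir_mul_vertexFunctional_printed_latN_eq hθ Dl w hf hh hr]
  constructor
  · simp [Complex.mul_re, Complex.mul_im]
  · simp [Complex.mul_im, Complex.mul_re]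

/-- ★★ **CONTINUITY ZEROS AT THE LATERAL CELL (route-mass form).** At the lateral cell `latN w` above the hole of
the root `w.side W`: if the route-mass difference `M_W − M_E` of the wound class-`B2a` walks is `≥ 0` at one printed angle
and `≤ 0` at another (in either order), the defect vanishes EXACTLY at some angle between them.
[cite: GlazmanManolescu2019, Lemma 2.1 (statement, "in the form given in [Gl]")] [cite: Glazman2015WeightedSAW, Lemma 3.1, eq. (1) (the weight v(θ) ≥ 0)]
[cite: DuminilCopinSmirnov2012, proof of Lemma 1] -/
theorem vertexFunctional_printed_latN_exists_eq_zero_of_routeMass_sign_change {θ₁ θ₂ : ℝ} (h12 : θ₁ ≤ θ₂)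
    (hθ₁ : θ₁ ∈ Set.Icc (π / 3) (2 * π / 3)) (hθ₂ : θ₂ ∈ Set.Icc (π / 3) (2 * π / 3))
    (Dl : List Face) (w : Face) (hf : latN w ∈ Dl) (hh : holeFaceW w ∉ dom Dl)
    (hr : RootedFace (dom Dl) (w.side .W) (latN w))
    (hsign : ((∑ ω ∈ ΩG.setB2a (dom Dl) (w.side .W) (latN w), ΩG.routeMassL θ₁ hr .W ω) -
          ∑ ω ∈ ΩG.setB2a (dom Dl) (w.side .W) (latN w), ΩG.routeMassL θ₁ hr .E ω) *
        ((∑ ω ∈ ΩG.setB2a (dom Dl) (w.side .W) (latN w), ΩG.routeMassL θ₂ hr .W ω) -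
          ∑ ω ∈ ΩG.setB2a (dom Dl) (w.side .W) (latN w), ΩG.routeMassL θ₂ hr .E ω) ≤ 0) :
    ∃ θ ∈ Set.Icc θ₁ θ₂,
      vertexFunctional (printedWeights θ) tFiveEighths (ybCoeff θ) Dl (w.side .W) (latN w) = 0 := by
  -- the rotated defect g(θ) = conj(latDir θ)·VF(θ) and its imaginary part
  set g : ℝ → ℂ := fun θ => (starRingEnd ℂ) (latDir θ) *
    vertexFunctional (printedWeights θ) tFiveEighths (ybCoeff θ) Dl (w.side .W) (latN w) with hg
  have h0₁ : 0 < θ₁ := by linarith [hθ₁.1, Real.pi_pos]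
  have hπ₂ : θ₂ < π := by linarith [hθ₂.2, Real.pi_pos]
  have hcontg : ContinuousOn g (Set.Icc θ₁ θ₂) := by
    have hc1 : Continuous fun θ => (starRingEnd ℂ) (latDir θ) := Complex.continuous_conj.comp continuous_latDir
    exact hc1.continuousOn.mul ((continuousOn_vertexFunctional_printed Dl (w.side .W) (latN w)).mono
      fun _ hθ => ⟨lt_of_lt_of_le h0₁ hθ.1, lt_of_le_of_lt hθ.2 hπ₂⟩)
  have hcont : ContinuousOn (fun θ => (g θ).im) (Set.Icc θ₁ θ₂) := Complex.continuous_im.comp_continuousOn hcontg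
  have hmem : ∀ θ ∈ Set.Icc θ₁ θ₂, θ ∈ Set.Icc (π / 3) (2 * π / 3) :=
    fun θ hθ => ⟨le_trans hθ₁.1 hθ.1, le_trans hθ.2 hθ₂.2⟩
  have him : ∀ θ ∈ Set.Icc θ₁ θ₂, (g θ).im = weightV θ *
      ((∑ ω ∈ ΩG.setB2a (dom Dl) (w.side .W) (latN w), ΩG.routeMassL θ hr .W ω) -
        ∑ ω ∈ ΩG.setB2a (dom Dl) (w.side .W) (latN w), ΩG.routeMassL θ hr .E ω) :=
    fun θ hθ => (conj_latDir_mul_vertexFunctional_printed_latN_re_im (hmem θ hθ) Dl w hf hh hr).2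
  have hsign' : (g θ₁).im * (g θ₂).im ≤ 0 := by
    rw [him θ₁ ⟨le_rfl, h12⟩, him θ₂ ⟨h12, le_rfl⟩]
    have hv := mul_nonneg (weightV_nonneg hθ₁) (weightV_nonneg hθ₂)
    have key := mul_nonpos_of_nonneg_of_nonpos hv hsign
    nlinarith [key]
  have hzero : ∃ θ ∈ Set.Icc θ₁ θ₂, (g θ).im = 0 := by
    rcases mul_nonpos_iff.1 hsign' with ⟨ha, hb⟩ | ⟨ha, hb⟩
    · obtain ⟨θ, hθ, hθ0⟩ := intermediate_value_Icc' h12 hcont ⟨hb, ha⟩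
      exact ⟨θ, hθ, hθ0⟩
    · obtain ⟨θ, hθ, hθ0⟩ := intermediate_value_Icc h12 hcont ⟨ha, hb⟩
      exact ⟨θ, hθ, hθ0⟩
  obtain ⟨θ, hθ, hθ0⟩ := hzero
  refine ⟨θ, hθ, ?_⟩
  have hre : (g θ).re = 0 := (conj_latDir_mul_vertexFunctional_printed_latN_re_im (hmem θ hθ) Dl w hf hh hr).1
  have hg0 : g θ = 0 := Complex.ext (by simpa using hre) (by simpa using hθ0)
  have hcz : (starRingEnd ℂ) (latDir θ) ≠ 0 := by
    rw [map_ne_zero]; exact latDir_ne_zero θ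
  exact (mul_eq_zero.1 hg0).resolve_left hcz

/-- ★★ **STRICT FORM AT THE LATERAL CELL: a zero in the OPEN interval**, provided the defect does not vanish at the
two end angles. [cite: GlazmanManolescu2019, Lemma 2.1 (statement, "in the form given in [Gl]")]
[cite: Glazman2015WeightedSAW, Lemma 3.1 (proof, pp. 6–7)] [cite: DuminilCopinSmirnov2012, proof of Lemma 1] -/
theorem vertexFunctional_printed_latN_exists_eq_zero_Ioo {θ₁ θ₂ : ℝ} (h12 : θ₁ ≤ θ₂)
    (hθ₁ : θ₁ ∈ Set.Icc (π / 3) (2 * π / 3)) (hθ₂ : θ₂ ∈ Set.Icc (π / 3) (2 * π / 3))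
    (Dl : List Face) (w : Face) (hf : latN w ∈ Dl) (hh : holeFaceW w ∉ dom Dl)
    (hr : RootedFace (dom Dl) (w.side .W) (latN w))
    (hsign : ((∑ ω ∈ ΩG.setB2a (dom Dl) (w.side .W) (latN w), ΩG.routeMassL θ₁ hr .W ω) -
          ∑ ω ∈ ΩG.setB2a (dom Dl) (w.side .W) (latN w), ΩG.routeMassL θ₁ hr .E ω) *
        ((∑ ω ∈ ΩG.setB2a (dom Dl) (w.side .W) (latN w), ΩG.routeMassL θ₂ hr .W ω) -
          ∑ ω ∈ ΩG.setB2a (dom Dl) (w.side .W) (latN w), ΩG.routeMassL θ₂ hr .E ω) ≤ 0)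
    (hne₁ : vertexFunctional (printedWeights θ₁) tFiveEighths (ybCoeff θ₁) Dl (w.side .W) (latN w) ≠ 0)
    (hne₂ : vertexFunctional (printedWeights θ₂) tFiveEighths (ybCoeff θ₂) Dl (w.side .W) (latN w) ≠ 0) :
    ∃ θ ∈ Set.Ioo θ₁ θ₂,
      vertexFunctional (printedWeights θ) tFiveEighths (ybCoeff θ) Dl (w.side .W) (latN w) = 0 := by
  obtain ⟨θ, hθ, hz⟩ :=
    vertexFunctional_printed_latN_exists_eq_zero_of_routeMass_sign_change h12 hθ₁ hθ₂ Dl w hf hh hr hsign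
  have h1 : θ ≠ θ₁ := fun e => hne₁ (e ▸ hz)
  have h2 : θ ≠ θ₂ := fun e => hne₂ (e ▸ hz)
  exact ⟨θ, ⟨lt_of_le_of_ne hθ.1 (Ne.symm h1), lt_of_le_of_ne hθ.2 h2⟩, hz⟩

end LateralCell

/-! ## §D (edition 3) The far cell in the three other orientations -/

section Orientations

/-- ★ **ROTATED LINE LEMMA.** If a rotation `c(θ)`, continuous and non-vanishing on `[θ₁, θ₂] ⊆ (0, π)`, makes the
printed vertex functional of `(Dl, a, f₀)` purely imaginary there (`Re(c·VF) = 0`), and `Im(c·VF)` has opposite weak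
signs at the two ends, then `VF` vanishes EXACTLY at some angle of `[θ₁, θ₂]`.
[cite: GlazmanManolescu2019, Lemma 2.1 and eq. (1)] -/
theorem vertexFunctional_printed_exists_eq_zero_of_rotated (Dl : List Face) (a : MidEdge) (f₀ : Face)
    (c : ℝ → ℂ) {θ₁ θ₂ : ℝ} (h12 : θ₁ ≤ θ₂) (h₁ : 0 < θ₁) (h₂ : θ₂ < π)
    (hc : ContinuousOn c (Set.Icc θ₁ θ₂)) (hc0 : ∀ θ ∈ Set.Icc θ₁ θ₂, c θ ≠ 0)
    (hre : ∀ θ ∈ Set.Icc θ₁ θ₂,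
      (c θ * vertexFunctional (printedWeights θ) tFiveEighths (ybCoeff θ) Dl a f₀).re = 0)
    (hsign : (c θ₁ * vertexFunctional (printedWeights θ₁) tFiveEighths (ybCoeff θ₁) Dl a f₀).im *
        (c θ₂ * vertexFunctional (printedWeights θ₂) tFiveEighths (ybCoeff θ₂) Dl a f₀).im ≤ 0) :
    ∃ θ ∈ Set.Icc θ₁ θ₂, vertexFunctional (printedWeights θ) tFiveEighths (ybCoeff θ) Dl a f₀ = 0 := by
  set g : ℝ → ℂ := fun θ => c θ * vertexFunctional (printedWeights θ) tFiveEighths (ybCoeff θ) Dl a f₀ with hg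
  have hcontg : ContinuousOn g (Set.Icc θ₁ θ₂) :=
    hc.mul ((continuousOn_vertexFunctional_printed Dl a f₀).mono
      fun _ hθ => ⟨lt_of_lt_of_le h₁ hθ.1, lt_of_le_of_lt hθ.2 h₂⟩)
  have hcont : ContinuousOn (fun θ => (g θ).im) (Set.Icc θ₁ θ₂) := Complex.continuous_im.comp_continuousOn hcontg
  have hzero : ∃ θ ∈ Set.Icc θ₁ θ₂, (g θ).im = 0 := by
    rcases mul_nonpos_iff.1 hsign with ⟨ha, hb⟩ | ⟨ha, hb⟩
    · obtain ⟨θ, hθ, hθ0⟩ := intermediate_value_Icc' h12 hcont ⟨hb, ha⟩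
      exact ⟨θ, hθ, hθ0⟩
    · obtain ⟨θ, hθ, hθ0⟩ := intermediate_value_Icc h12 hcont ⟨ha, hb⟩
      exact ⟨θ, hθ, hθ0⟩
  obtain ⟨θ, hθ, hθ0⟩ := hzero
  refine ⟨θ, hθ, ?_⟩
  have hre' : (g θ).re = 0 := hre θ hθ
  have hg0 : g θ = 0 := Complex.ext (by simpa using hre') (by simpa using hθ0)
  exact (mul_eq_zero.1 hg0).resolve_left (hc0 θ hθ)

/-- ★★ **CONTINUITY ZEROS, hole EAST of the root plaquette** (root = the `E` side of `w`, hole `(w.1 + 1, w.2)`, far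
cell `(w.1 + 2, w.2)`): a weak sign change of `Im VF` between two printed angles forces an exact zero in between.
[cite: GlazmanManolescu2019, Lemma 2.1 (statement, "in the form given in [Gl]") and §1 (the remark on θ ↔ π − θ)]
[cite: Glazman2015WeightedSAW, Lemma 3.1 (proof, pp. 6–7)] -/
theorem vertexFunctional_printed_farCellE_exists_eq_zero_of_im_mul_im_nonpos {θ₁ θ₂ : ℝ} (h12 : θ₁ ≤ θ₂)
    (hθ₁ : θ₁ ∈ Set.Icc (π / 3) (2 * π / 3)) (hθ₂ : θ₂ ∈ Set.Icc (π / 3) (2 * π / 3))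
    (Dl : List Face) (w : Face) (hf : (w.1 + 2, w.2) ∈ Dl) (hh : (w.1 + 1, w.2) ∉ dom Dl)
    (hsign : (vertexFunctional (printedWeights θ₁) tFiveEighths (ybCoeff θ₁) Dl (w.side .E) (w.1 + 2, w.2)).im *
        (vertexFunctional (printedWeights θ₂) tFiveEighths (ybCoeff θ₂) Dl (w.side .E) (w.1 + 2, w.2)).im ≤ 0) :
    ∃ θ ∈ Set.Icc θ₁ θ₂,
      vertexFunctional (printedWeights θ) tFiveEighths (ybCoeff θ) Dl (w.side .E) (w.1 + 2, w.2) = 0 :=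
  vertexFunctional_printed_exists_eq_zero_of_re_eq_zero Dl (w.side .E) (w.1 + 2, w.2) h12 (pos_of_mem_printed hθ₁)
    (lt_pi_of_mem_printed hθ₂)
    (fun _ hθ => vertexFunctional_printed_farCellE_re_eq_zero
      ⟨le_trans hθ₁.1 hθ.1, le_trans hθ.2 hθ₂.2⟩ Dl w hf hh)
    hsign

/-- The rotation `conj r(θ)` is continuous. [cite: GlazmanManolescu2019, Lemma 2.1, eq. (CR) (the coefficient r(θ))] -/
theorem continuous_conj_ybRatio : Continuous fun θ => (starRingEnd ℂ) (ybRatio θ) :=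
  Complex.continuous_conj.comp (by
    unfold ybRatio
    exact Complex.continuous_exp.comp ((Complex.continuous_ofReal.comp (by fun_prop)).mul continuous_const))

/-- ★★ **CONTINUITY ZEROS, hole BELOW the root plaquette** (root = the `S` side of `w`, hole `(w.1, w.2 − 1)`, far cell
`(w.1, w.2 − 2)`): the defect lies on the line `i·r(θ)·ℝ`; a weak sign change of `Im(conj r(θ)·VF)` between two printed
angles forces an exact zero in between. [cite: GlazmanManolescu2019, Lemma 2.1 and eq. (CR) (the coefficient r(θ))]
[cite: Glazman2015WeightedSAW, Lemma 3.1 (proof, pp. 6–7)] -/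
theorem vertexFunctional_printed_farCellS_exists_eq_zero_of_rotated_im_mul_nonpos {θ₁ θ₂ : ℝ} (h12 : θ₁ ≤ θ₂)
    (hθ₁ : θ₁ ∈ Set.Icc (π / 3) (2 * π / 3)) (hθ₂ : θ₂ ∈ Set.Icc (π / 3) (2 * π / 3))
    (Dl : List Face) (w : Face) (hf : (w.1, w.2 - 2) ∈ Dl) (hh : (w.1, w.2 - 1) ∉ dom Dl)
    (hsign : ((starRingEnd ℂ) (ybRatio θ₁) *
          vertexFunctional (printedWeights θ₁) tFiveEighths (ybCoeff θ₁) Dl (w.side .S) (w.1, w.2 - 2)).im *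
        ((starRingEnd ℂ) (ybRatio θ₂) *
          vertexFunctional (printedWeights θ₂) tFiveEighths (ybCoeff θ₂) Dl (w.side .S) (w.1, w.2 - 2)).im ≤ 0) :
    ∃ θ ∈ Set.Icc θ₁ θ₂,
      vertexFunctional (printedWeights θ) tFiveEighths (ybCoeff θ) Dl (w.side .S) (w.1, w.2 - 2) = 0 :=
  vertexFunctional_printed_exists_eq_zero_of_rotated Dl (w.side .S) (w.1, w.2 - 2) (fun θ => (starRingEnd ℂ) (ybRatio θ))
    h12 (pos_of_mem_printed hθ₁) (lt_pi_of_mem_printed hθ₂) continuous_conj_ybRatio.continuousOn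
    (fun θ _ => by rw [map_ne_zero]; exact ybRatio_ne_zero θ)
    (fun _ hθ => vertexFunctional_printed_farCellS_re_eq_zero
      ⟨le_trans hθ₁.1 hθ.1, le_trans hθ.2 hθ₂.2⟩ Dl w hf hh)
    hsign

/-- ★★ **CONTINUITY ZEROS, hole ABOVE the root plaquette** (root = the `N` side of `w`, hole `(w.1, w.2 + 1)`, far cell
`(w.1, w.2 + 2)`): a weak sign change of `Im(conj r(θ)·VF)` between two printed angles forces an exact zero in between.
[cite: GlazmanManolescu2019, Lemma 2.1 and eq. (CR) (the coefficient r(θ))] [cite: Glazman2015WeightedSAW, Lemma 3.1 (proof, pp. 6–7)] -/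
theorem vertexFunctional_printed_farCellN_exists_eq_zero_of_rotated_im_mul_nonpos {θ₁ θ₂ : ℝ} (h12 : θ₁ ≤ θ₂)
    (hθ₁ : θ₁ ∈ Set.Icc (π / 3) (2 * π / 3)) (hθ₂ : θ₂ ∈ Set.Icc (π / 3) (2 * π / 3))
    (Dl : List Face) (w : Face) (hf : (w.1, w.2 + 2) ∈ Dl) (hh : (w.1, w.2 + 1) ∉ dom Dl)
    (hsign : ((starRingEnd ℂ) (ybRatio θ₁) *
          vertexFunctional (printedWeights θ₁) tFiveEighths (ybCoeff θ₁) Dl (w.side .N) (w.1, w.2 + 2)).im *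
        ((starRingEnd ℂ) (ybRatio θ₂) *
          vertexFunctional (printedWeights θ₂) tFiveEighths (ybCoeff θ₂) Dl (w.side .N) (w.1, w.2 + 2)).im ≤ 0) :
    ∃ θ ∈ Set.Icc θ₁ θ₂,
      vertexFunctional (printedWeights θ) tFiveEighths (ybCoeff θ) Dl (w.side .N) (w.1, w.2 + 2) = 0 :=
  vertexFunctional_printed_exists_eq_zero_of_rotated Dl (w.side .N) (w.1, w.2 + 2) (fun θ => (starRingEnd ℂ) (ybRatio θ))
    h12 (pos_of_mem_printed hθ₁) (lt_pi_of_mem_printed hθ₂) continuous_conj_ybRatio.continuousOn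
    (fun θ _ => by rw [map_ne_zero]; exact ybRatio_ne_zero θ)
    (fun _ hθ => vertexFunctional_printed_farCellN_re_eq_zero
      ⟨le_trans hθ₁.1 hθ.1, le_trans hθ.2 hθ₂.2⟩ Dl w hf hh)
    hsign

end Orientations

/-! ## §E (edition 4) The lateral cell BELOW the hole: continuity zeros from the ring's cell law at `LS` -/

section LateralCellSouth

/-- Conjugating the `LS` rotation phase negates its angle: `conj(e^{i·3θ/8}) = e^{−i·3θ/8}`. [folklore] -/
private theorem conj_lsRot_eq_cexp_neg (θ : ℝ) :
    (starRingEnd ℂ) (Complex.exp ((((3 * θ / 8 : ℝ)) : ℂ) * Complex.I)) =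
      Complex.exp ((((-(3 * θ / 8) : ℝ)) : ℂ) * Complex.I) := by
  rw [← Complex.exp_conj, map_mul, Complex.conj_ofReal, Complex.conj_I]
  congr 1; push_cast; ring

/-- `conj(e^{i·3θ/8}) · e^{i·3θ/8} = 1`. [folklore] -/
private theorem conj_lsRot_mul_cexp_W (θ : ℝ) :
    (starRingEnd ℂ) (Complex.exp ((((3 * θ / 8 : ℝ)) : ℂ) * Complex.I)) *
      Complex.exp ((((3 * θ / 8 : ℝ)) : ℂ) * Complex.I) = 1 := by
  rw [conj_lsRot_eq_cexp_neg, ← Complex.exp_add, ← add_mul, ← Complex.ofReal_add]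
  norm_num

/-- `conj(e^{i·3θ/8}) · e^{i(3θ/8 + π)} = −1`. [folklore] -/
private theorem conj_lsRot_mul_cexp_E (θ : ℝ) :
    (starRingEnd ℂ) (Complex.exp ((((3 * θ / 8 : ℝ)) : ℂ) * Complex.I)) *
      Complex.exp ((((3 * θ / 8 + π : ℝ)) : ℂ) * Complex.I) = -1 := by
  rw [conj_lsRot_eq_cexp_neg, ← Complex.exp_add, ← add_mul, ← Complex.ofReal_add,
    show (-(3 * θ / 8) + (3 * θ / 8 + π) : ℝ) = π by ring]
  exact_mod_cast Complex.exp_pi_mul_I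

/-- The rotation `conj(e^{i·3θ/8})` is continuous in the angle. [cite: Glazman2015WeightedSAW, Lemma 3.1, eq. (1) (the weights)] -/
theorem continuous_conj_lsRot :
    Continuous fun θ : ℝ => (starRingEnd ℂ) (Complex.exp ((((3 * θ / 8 : ℝ)) : ℂ) * Complex.I)) :=
  Complex.continuous_conj.comp
    (Complex.continuous_exp.comp ((Complex.continuous_ofReal.comp (by fun_prop)).mul continuous_const))

/-- The rotation `conj(e^{i·3θ/8})` never vanishes. [cite: Glazman2015WeightedSAW, Lemma 3.1, eq. (1) (the weights)] -/
theorem conj_lsRot_ne_zero (θ : ℝ) :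
    (starRingEnd ℂ) (Complex.exp ((((3 * θ / 8 : ℝ)) : ℂ) * Complex.I)) ≠ 0 := by
  rw [map_ne_zero]; exact Complex.exp_ne_zero _

/-- At cell `LS` a realizable class direction with first side `W` is `e^{i·3θ/8}`.
[cite: Glazman2015WeightedSAW, Lemma 3.1 (proof, pp. 6–7: the classes of walks through a rhombus)] -/
theorem dirLS_of_W (θ : ℝ) {z₀ z₁ z₂ : Side} (h01 : z₀ ≠ z₁) (h02 : z₀ ≠ z₂) (h12 : z₁ ≠ z₂)
    (hN : z₀ ≠ .N ∧ z₁ ≠ .N ∧ z₂ ≠ .N) (hz : z₀ = .W) :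
    dirLS θ z₀ z₁ z₂ = Complex.exp ((((3 * θ / 8 : ℝ)) : ℂ) * Complex.I) := by
  obtain ⟨hN0, hN1, hN2⟩ := hN
  subst hz
  cases z₁ <;> cases z₂ <;> first
    | exact absurd rfl h01
    | exact absurd rfl h02
    | exact absurd rfl h12
    | exact absurd rfl hN1
    | exact absurd rfl hN2
    | rfl

/-- At cell `LS` a realizable class direction with first side `E` is `e^{i(3θ/8 + π)}` — ANTIPODAL to the `W` direction.
[cite: Glazman2015WeightedSAW, Lemma 3.1 (proof, pp. 6–7: the classes of walks through a rhombus)] -/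
theorem dirLS_of_E (θ : ℝ) {z₀ z₁ z₂ : Side} (h01 : z₀ ≠ z₁) (h02 : z₀ ≠ z₂) (h12 : z₁ ≠ z₂)
    (hN : z₀ ≠ .N ∧ z₁ ≠ .N ∧ z₂ ≠ .N) (hz : z₀ = .E) :
    dirLS θ z₀ z₁ z₂ = Complex.exp ((((3 * θ / 8 + π : ℝ)) : ℂ) * Complex.I) := by
  obtain ⟨hN0, hN1, hN2⟩ := hN
  subst hz
  cases z₁ <;> cases z₂ <;> first
    | exact absurd rfl h01
    | exact absurd rfl h02
    | exact absurd rfl h12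
    | exact absurd rfl hN1
    | exact absurd rfl hN2
    | rfl

/-- ★ **The rotated class term at `LS` of a WOUND walk entering from `W` is `+ext`** (a non-negative real).
[cite: GlazmanManolescu2019, Lemma 2.1 (statement, "in the form given in [Gl]")] [cite: Glazman2015WeightedSAW, Lemma 3.1 (proof, pp. 6–7)] -/
theorem conj_lsRot_mul_classTermLS_of_W {D : Set Face} {w : Face} (hh : holeFaceW w ∉ D) (θ : ℝ)
    (hr : RootedFace D (w.side .W) (latS w)) (ω : ΩG D (w.side .W) (latS w)) (h : ω.IsB2a)
    (hw : ω.WE (fun _ => θ) ≠ excursionWinding θ ω.2.firstSideG (ω.z1 hr h) ω.1) (hz : ω.2.firstSideG = .W) :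
    (starRingEnd ℂ) (Complex.exp ((((3 * θ / 8 : ℝ)) : ℂ) * Complex.I)) * ΩG.classTermLS θ hr ω =
      ((ω.2.extWeight (fun _ => θ) (latS w) : ℝ) : ℂ) := by
  obtain ⟨hz01, hz02, hz12⟩ := ω.firstSide_exit_return_distinct hr h
  have hN := ΩG.LS_sides_ne_N hh hr h
  rw [ΩG.classTermLS, dif_pos h, if_pos hw, dirLS_of_W θ hz01 hz02 hz12 hN hz, mul_left_comm,
    conj_lsRot_mul_cexp_W, mul_one]

/-- ★ **The rotated class term at `LS` of a WOUND walk entering from `E` is `−ext`** (a non-positive real).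
[cite: GlazmanManolescu2019, Lemma 2.1 (statement, "in the form given in [Gl]")] [cite: Glazman2015WeightedSAW, Lemma 3.1 (proof, pp. 6–7)] -/
theorem conj_lsRot_mul_classTermLS_of_E {D : Set Face} {w : Face} (hh : holeFaceW w ∉ D) (θ : ℝ)
    (hr : RootedFace D (w.side .W) (latS w)) (ω : ΩG D (w.side .W) (latS w)) (h : ω.IsB2a)
    (hw : ω.WE (fun _ => θ) ≠ excursionWinding θ ω.2.firstSideG (ω.z1 hr h) ω.1) (hz : ω.2.firstSideG = .E) :
    (starRingEnd ℂ) (Complex.exp ((((3 * θ / 8 : ℝ)) : ℂ) * Complex.I)) * ΩG.classTermLS θ hr ω =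
      -((ω.2.extWeight (fun _ => θ) (latS w) : ℝ) : ℂ) := by
  obtain ⟨hz01, hz02, hz12⟩ := ω.firstSide_exit_return_distinct hr h
  have hN := ΩG.LS_sides_ne_N hh hr h
  rw [ΩG.classTermLS, dif_pos h, if_pos hw, dirLS_of_E θ hz01 hz02 hz12 hN hz, mul_left_comm,
    conj_lsRot_mul_cexp_E, mul_neg, mul_one]

/-- The class term at `LS` of an UNWOUND class-`B2a` walk vanishes. [cite: GlazmanManolescu2019, Lemma 2.1 (statement, "in the form given in [Gl]")] -/
theorem classTermLS_of_not_wound {D : Set Face} {w : Face} (θ : ℝ)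
    (hr : RootedFace D (w.side .W) (latS w)) (ω : ΩG D (w.side .W) (latS w)) (h : ω.IsB2a)
    (hw : ¬ ω.WE (fun _ => θ) ≠ excursionWinding θ ω.2.firstSideG (ω.z1 hr h) ω.1) :
    ΩG.classTermLS θ hr ω = 0 := by
  rw [ΩG.classTermLS, dif_pos h, if_neg hw]

/-- ★ **After rotation by `conj(e^{i·3θ/8})` every class term at `LS` is REAL** (imaginary part `0`), for every
class-`B2a` walk. [cite: GlazmanManolescu2019, Lemma 2.1 (statement, "in the form given in [Gl]")] [cite: Glazman2015WeightedSAW, Lemma 3.1 (proof, pp. 6–7)] -/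
theorem im_conj_lsRot_mul_classTermLS_eq_zero {D : Set Face} {w : Face} (hh : holeFaceW w ∉ D) (θ : ℝ)
    (hr : RootedFace D (w.side .W) (latS w)) (ω : ΩG D (w.side .W) (latS w)) (h : ω.IsB2a) :
    ((starRingEnd ℂ) (Complex.exp ((((3 * θ / 8 : ℝ)) : ℂ) * Complex.I)) * ΩG.classTermLS θ hr ω).im = 0 := by
  by_cases hw : ω.WE (fun _ => θ) ≠ excursionWinding θ ω.2.firstSideG (ω.z1 hr h) ω.1
  · rcases ΩG.LS_firstSide_eq_E_or_W hh hr h with hz | hz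
    · rw [conj_lsRot_mul_classTermLS_of_E hh θ hr ω h hw hz]; simp
    · rw [conj_lsRot_mul_classTermLS_of_W hh θ hr ω h hw hz]; simp
  · rw [classTermLS_of_not_wound θ hr ω h hw, mul_zero, Complex.zero_im]

/-- ★★ **THE ROTATED DEFECT BELOW THE HOLE.** For `θ ∈ [π/3, 2π/3]`, `latS w ∈ Dl`, `holeFaceW w ∉ dom Dl`:
`conj(e^{i·3θ/8})·VF_D(w.side W, latS w)` has vanishing REAL part and imaginary part
`v(θ)·Σ_{B2a} Re(conj(e^{i·3θ/8})·classTermLS)` = `v(θ)·(M_W − M_E)`, the signed exterior mass of the wound walks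
(`+` from `W`, `−` from `E`). The defect below the hole lies on the rotating line `i·e^{i·3θ/8}·ℝ` — the row-mirror
image of the lateral-cell line `i·e^{i(3θ/8 + 5π/8)}·ℝ`… up to the mirror's conjugation of directions.
[cite: GlazmanManolescu2019, Lemma 2.1 (statement, "in the form given in [Gl]")] [cite: Glazman2015WeightedSAW, Lemma 3.1 (proof, pp. 6–7)]
[cite: Hopf1935, Nr. 2 (Umlaufsatz, p. 53) and Nr. 4 eq. (22) (curves with corners, pp. 60–61)] -/
theorem conj_lsRot_mul_vertexFunctional_printed_latS_re_im {θ : ℝ} (hθ : θ ∈ Set.Icc (π / 3) (2 * π / 3))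
    (Dl : List Face) (w : Face) (hf : latS w ∈ Dl) (hh : holeFaceW w ∉ dom Dl)
    (hr : RootedFace (dom Dl) (w.side .W) (latS w)) :
    ((starRingEnd ℂ) (Complex.exp ((((3 * θ / 8 : ℝ)) : ℂ) * Complex.I)) *
        vertexFunctional (printedWeights θ) tFiveEighths (ybCoeff θ) Dl (w.side .W) (latS w)).re = 0 ∧
      ((starRingEnd ℂ) (Complex.exp ((((3 * θ / 8 : ℝ)) : ℂ) * Complex.I)) *
          vertexFunctional (printedWeights θ) tFiveEighths (ybCoeff θ) Dl (w.side .W) (latS w)).im =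
        weightV θ * ∑ ω ∈ ΩG.setB2a (dom Dl) (w.side .W) (latS w),
          ((starRingEnd ℂ) (Complex.exp ((((3 * θ / 8 : ℝ)) : ℂ) * Complex.I)) * ΩG.classTermLS θ hr ω).re := by
  classical
  set c : ℂ := (starRingEnd ℂ) (Complex.exp ((((3 * θ / 8 : ℝ)) : ℂ) * Complex.I)) with hc
  set S : ℂ := ∑ ω ∈ ΩG.setB2a (dom Dl) (w.side .W) (latS w), c * ΩG.classTermLS θ hr ω with hS
  have hSim : S.im = 0 := by
    rw [hS, Complex.im_sum]
    refine Finset.sum_eq_zero fun ω hω => ?_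
    simp only [ΩG.setB2a, Finset.mem_filter, Finset.mem_univ, true_and] at hω
    exact im_conj_lsRot_mul_classTermLS_eq_zero hh θ hr ω hω
  have hSre : S.re = ∑ ω ∈ ΩG.setB2a (dom Dl) (w.side .W) (latS w), (c * ΩG.classTermLS θ hr ω).re := by
    rw [hS, Complex.re_sum]
  have key : c * vertexFunctional (printedWeights θ) tFiveEighths (ybCoeff θ) Dl (w.side .W) (latS w) =
      Complex.I * (weightV θ : ℂ) * S := by
    rw [vertexFunctional_printed_LS_eq hθ Dl w hf hh hr, hS, ← Finset.mul_sum]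
    ring
  rw [key]
  constructor
  · simp [Complex.mul_re, Complex.mul_im, hSim]
  · simp [Complex.mul_re, Complex.mul_im, hSim, hSre]

/-- ★★ **CONTINUITY ZEROS BELOW THE HOLE (signed-mass form; the row-mirror twin of §C).** At the lateral cell `latS w`
below the hole of the root `w.side W`: if the signed wound mass `M_W − M_E = Σ_{B2a} Re(conj(e^{i·3θ/8})·classTermLS)` is
`≥ 0` at one printed angle and `≤ 0` at another (in either order), the defect vanishes EXACTLY at some angle between them.
[cite: GlazmanManolescu2019, Lemma 2.1 (statement, "in the form given in [Gl]")] [cite: Glazman2015WeightedSAW, Lemma 3.1, eq. (1) (the weight v(θ) ≥ 0)]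
[cite: DuminilCopinSmirnov2012, proof of Lemma 1] -/
theorem vertexFunctional_printed_latS_exists_eq_zero_of_signedMass_sign_change {θ₁ θ₂ : ℝ} (h12 : θ₁ ≤ θ₂)
    (hθ₁ : θ₁ ∈ Set.Icc (π / 3) (2 * π / 3)) (hθ₂ : θ₂ ∈ Set.Icc (π / 3) (2 * π / 3))
    (Dl : List Face) (w : Face) (hf : latS w ∈ Dl) (hh : holeFaceW w ∉ dom Dl)
    (hr : RootedFace (dom Dl) (w.side .W) (latS w))
    (hsign : (∑ ω ∈ ΩG.setB2a (dom Dl) (w.side .W) (latS w),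
          ((starRingEnd ℂ) (Complex.exp ((((3 * θ₁ / 8 : ℝ)) : ℂ) * Complex.I)) * ΩG.classTermLS θ₁ hr ω).re) *
        (∑ ω ∈ ΩG.setB2a (dom Dl) (w.side .W) (latS w),
          ((starRingEnd ℂ) (Complex.exp ((((3 * θ₂ / 8 : ℝ)) : ℂ) * Complex.I)) * ΩG.classTermLS θ₂ hr ω).re) ≤ 0) :
    ∃ θ ∈ Set.Icc θ₁ θ₂,
      vertexFunctional (printedWeights θ) tFiveEighths (ybCoeff θ) Dl (w.side .W) (latS w) = 0 := by
  have hmem : ∀ θ ∈ Set.Icc θ₁ θ₂, θ ∈ Set.Icc (π / 3) (2 * π / 3) :=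
    fun θ hθ => ⟨le_trans hθ₁.1 hθ.1, le_trans hθ.2 hθ₂.2⟩
  refine vertexFunctional_printed_exists_eq_zero_of_rotated Dl (w.side .W) (latS w)
    (fun θ => (starRingEnd ℂ) (Complex.exp ((((3 * θ / 8 : ℝ)) : ℂ) * Complex.I)))
    h12 (pos_of_mem_printed hθ₁) (lt_pi_of_mem_printed hθ₂) continuous_conj_lsRot.continuousOn
    (fun θ _ => conj_lsRot_ne_zero θ)
    (fun θ hθ => (conj_lsRot_mul_vertexFunctional_printed_latS_re_im (hmem θ hθ) Dl w hf hh hr).1) ?_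
  rw [(conj_lsRot_mul_vertexFunctional_printed_latS_re_im hθ₁ Dl w hf hh hr).2,
    (conj_lsRot_mul_vertexFunctional_printed_latS_re_im hθ₂ Dl w hf hh hr).2]
  have hv := mul_nonneg (weightV_nonneg hθ₁) (weightV_nonneg hθ₂)
  have key := mul_nonpos_of_nonneg_of_nonpos hv hsign
  nlinarith [key]

/-- ★★ **STRICT FORM BELOW THE HOLE: a zero in the OPEN interval**, provided the defect does not vanish at the two end
angles. [cite: GlazmanManolescu2019, Lemma 2.1 (statement, "in the form given in [Gl]")]
[cite: Glazman2015WeightedSAW, Lemma 3.1 (proof, pp. 6–7)] [cite: DuminilCopinSmirnov2012, proof of Lemma 1] -/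
theorem vertexFunctional_printed_latS_exists_eq_zero_Ioo {θ₁ θ₂ : ℝ} (h12 : θ₁ ≤ θ₂)
    (hθ₁ : θ₁ ∈ Set.Icc (π / 3) (2 * π / 3)) (hθ₂ : θ₂ ∈ Set.Icc (π / 3) (2 * π / 3))
    (Dl : List Face) (w : Face) (hf : latS w ∈ Dl) (hh : holeFaceW w ∉ dom Dl)
    (hr : RootedFace (dom Dl) (w.side .W) (latS w))
    (hsign : (∑ ω ∈ ΩG.setB2a (dom Dl) (w.side .W) (latS w),
          ((starRingEnd ℂ) (Complex.exp ((((3 * θ₁ / 8 : ℝ)) : ℂ) * Complex.I)) * ΩG.classTermLS θ₁ hr ω).re) *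
        (∑ ω ∈ ΩG.setB2a (dom Dl) (w.side .W) (latS w),
          ((starRingEnd ℂ) (Complex.exp ((((3 * θ₂ / 8 : ℝ)) : ℂ) * Complex.I)) * ΩG.classTermLS θ₂ hr ω).re) ≤ 0)
    (hne₁ : vertexFunctional (printedWeights θ₁) tFiveEighths (ybCoeff θ₁) Dl (w.side .W) (latS w) ≠ 0)
    (hne₂ : vertexFunctional (printedWeights θ₂) tFiveEighths (ybCoeff θ₂) Dl (w.side .W) (latS w) ≠ 0) :
    ∃ θ ∈ Set.Ioo θ₁ θ₂,
      vertexFunctional (printedWeights θ) tFiveEighths (ybCoeff θ) Dl (w.side .W) (latS w) = 0 := by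
  obtain ⟨θ, hθ, hz⟩ :=
    vertexFunctional_printed_latS_exists_eq_zero_of_signedMass_sign_change h12 hθ₁ hθ₂ Dl w hf hh hr hsign
  have h1 : θ ≠ θ₁ := fun e => hne₁ (e ▸ hz)
  have h2 : θ ≠ θ₂ := fun e => hne₂ (e ▸ hz)
  exact ⟨θ, ⟨lt_of_le_of_ne hθ.1 (Ne.symm h1), lt_of_le_of_ne hθ.2 h2⟩, hz⟩

end LateralCellSouth

end Literature.Barriers.CriticalPhenomena.PlaquetteWalk

end
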